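import Summits.AtomisticToContinuum.Crystallization.Theorems.ChessboardParticlePlanesPeriodicWindowsStubOffsetLayerCake
import Summits.AtomisticToContinuum.Crystallization.Theorems.ChessboardParticlePlanesPeriodicWindowsStubOffsetLayerDecay
import Summits.AtomisticToContinuum.Crystallization.Theorems.ChessboardParticlePlanesPeriodicWindowsStubLayeredPrisms

/-!
# Crux `PeriodicWindows` (stmt-AtomisticToContinuum-3240), line `dense-laminar-hull` — LC-C: the energy of a prism of a general
# layered set, layer by layer (ROADMAP step 1 of the registry engine of P3b2′; lead c11)

For `a ≥ 7/10` and the general layered set `S = B '' {i v₁(a) + j v₂(a) + δ m + z m e₃}` (`B` a linear isometry preserving the third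
coordinate, horizontal offsets `δ`, strictly increasing heights with gaps `≥ 3/4`), the sum of the site energies over the index box of
the prism `W(m₁, n, K)` of `stub_layeredPrisms` (GS2) is `K²` times the sum over the layers `m₁ ≤ m < m₁ + n` of
`Φ₀(a) + Σ'_{m' ≠ m} Φ(a, z m' − z m, δ m' − δ m)`, with the general-offset layer interaction
`Φ(a, H, θ) = Σ'_{(i,j)∈ℤ²} V_LJ ‖i v₁ + j v₂ + θ + H e₃‖` written inline: `stub_offsetLayerCake` (LC-A, p166078) at every site with the
analytic inputs of `stub_offsetLayerDecay` (LC-B, p165966), summed with `LayeredHull.cake_sum_box_layer`. Together with GS2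
(`#W = nK²`, boundary functional `O(nK + K²)`) this is the general-offset analogue of `LayeredHull.cake_prisms` (item 11779).
[folklore]
-/

noncomputable section

namespace Summit.AtomisticToContinuum.Crystallization.Theorems.PeriodicWindowsDenseLaminarHull

open Literature.MathematicalPhysics.StatisticalMechanics Filter Metric
open scoped BigOperators

/-- **LC-C: the energy of a prism of a general layered set, layer by layer** (see the module docstring). [folklore] -/
theorem gs_prismEnergy : ∀ a : ℝ, (7 : ℝ) / 10 ≤ a →
    ∀ (B : EuclideanSpace ℝ (Fin 3) ≃ₗᵢ[ℝ] EuclideanSpace ℝ (Fin 3)) (δ : ℤ → EuclideanSpace ℝ (Fin 3)) (z : ℤ → ℝ),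
    (∀ p : EuclideanSpace ℝ (Fin 3), (B p) 2 = p 2) → (∀ m : ℤ, (δ m) 2 = 0) → StrictMono z →
    (∀ m : ℤ, (3 : ℝ) / 4 ≤ z (m + 1) - z m) → ∀ (m₁ : ℤ) (n K : ℕ),
    ∑ t ∈ (Finset.Ico m₁ (m₁ + n)) ×ˢ ((Finset.range K) ×ˢ (Finset.range K)),
      (∑' q : {q : EuclideanSpace ℝ (Fin 3) // q ∈ (fun p => B p) '' {p | ∃ m i j : ℤ, p = ((i : ℝ) • triangularVec₁ a) +
          ((j : ℝ) • triangularVec₂ a) + δ m + (z m • layerNormal 1)} ∧ q ≠ B (((t.2.1 : ℝ) • triangularVec₁ a) +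
          ((t.2.2 : ℝ) • triangularVec₂ a) + δ t.1 + (z t.1 • layerNormal 1))},
        lennardJones (dist (B (((t.2.1 : ℝ) • triangularVec₁ a) + ((t.2.2 : ℝ) • triangularVec₂ a) + δ t.1 +
          (z t.1 • layerNormal 1))) (q : EuclideanSpace ℝ (Fin 3)))) =
    (K : ℝ) ^ 2 * ∑ m ∈ Finset.Ico m₁ (m₁ + n), (inLayerInteraction lennardJones a +
      ∑' m' : ℤ, if m' = m then (0 : ℝ) else
        ∑' ij : ℤ × ℤ, lennardJones ‖((ij.1 : ℝ)) • triangularVec₁ a + ((ij.2 : ℝ)) • triangularVec₂ a +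
          (δ m' - δ m) + (z m' - z m) • layerNormal 1‖) := by
  intro a ha B δ z hB hδ hz hgap m₁ n K
  obtain ⟨hin, hdec⟩ := stub_offsetLayerDecay a ha
  rw [← LayeredHull.cake_sum_box_layer]
  refine Finset.sum_congr rfl fun t _ => ?_
  have e := (stub_offsetLayerCake a ha B δ z hB hδ hz hgap hin hdec t.1 t.2.1 t.2.2).2
  simp only [Int.cast_natCast] at e
  exact e

end Summit.AtomisticToContinuum.Crystallization.Theorems.PeriodicWindowsDenseLaminarHull

end
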